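import Mathlib
import Literature.MathematicalPhysics.QuantumFieldTheory.Dimock2011to13.MultiRegionFreeFlow
import Literature.MathematicalPhysics.QuantumFieldTheory.Dimock2011to13.MinimizerSupNormBound

/-!
# Dimock, *The renormalization group according to Balaban* II, §3.2 LEMMA 3.1 (`\label{threeone}`) part (2), the converse
# «|Φ_k| ≤ p_kα_k^{−1}, |∂Φ_k| ≤ p_k ⟹ Φ_k ∈ C𝒮_k(□)»: the identity (samsum) SPLITTING OFF THE CONSTANT FIELD
# `φ_{k,Ω(□)}(Q̃ᵀΦ_k) = φ_{k,Ω(□)}(Q̃ᵀ(Φ_k − Φ_k(y))) + [1 − μ̄_kG_{k,Ω(□)}·1]Φ_k(y)`, the arithmetic (cindy)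
# `μ̄_kp_kα_k^{−1} ≤ μ̄_k^{1/2}p_k ≤ p_k`, the Lipschitz-source assembly (samsum3) `Σ_{y′}e^{−¼γ₀d(y,y′)}(d(y,y′)+1)p_k ≤ Cp_k`
# and the last step `Φ_k(y) − [Q(1 − μ̄_kG·1)](y)Φ_k(y) = μ̄_k(QG·1)(y)Φ_k(y)` — ALL PROVED; the kernel bounds
# (twoone1)∕(lefty2) and `|∂G_{k,Ω(□)}·1| ≤ C` stay the hypotheses they are in the printed proof

**Citation header (reproduction of PUBLISHED work; template of the Bałaban lattice Yang–Mills cell).**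
J. Dimock, *The renormalization group according to Balaban II. Large fields*, J. Math. Phys. **54** (2013) 092301
(= arXiv:1212.5562v2) [Dimock2013BalabanII], §3.2 `\subsection{bounds on fields}`: `p_k`, `α_k` L2050–2058, DEFINITION 3.1
`\label{s}` L2063–2077, LEMMA 3.1 `\label{threeone}` (= Lemma 3.1 of §3; TEMPLATE §9) L2103–2116 with its proof, part (1)
L2121–2138 and part (2) L2142–2207 *"Proof. [Bal82b], [Bal95]"* (L2119); the prescaled reprise (samsum5) in the proof of
LEMMA 3.12 `\label{replace}` L3989–4013.  TeX line numbers refer to the arXiv source held by the cell on this hub at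
`run/shared/lean/archive/nearmiss/qft-balaban/dimock/src/1212.5562/1212.5562.tex` (7217 lines, sha256[:16]
75c5792fc48eacbc).  Dimock's papers are published and refereed and are the cell's TEMPLATE, not manuscripts under
audit; no quantity of the Bałaban series is touched.

**What the paper prints (verbatim).**  LEMMA 3.1 (2) L2110–2115: *"Conversely if μ̄ ≤ 1 and on □^{∼(2R+1)} |Φ_k| ≤ p_kα_k^{−1},
|∂Φ_k| ≤ p_k then Φ_k ∈ C𝒮_k(□), i.e. the bounds (yass1) hold with a constant C on the right."*  Proof L2142–2207:
*"(2.) We need |φ_{k,Ω(□)}| ≤ Cα_k^{−1}p_k on □̃. … we can use (twoone1) to estimate on □̃ that |φ_{k,Ω(□)}| ≤ C‖Φ_k‖_∞ …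
For the derivative we can get the same bound, but we need the better bound |∂φ_{k,Ω(□)}| ≤ Cp_k on □̃. For this we use
the following identity. Let y be unit lattice point in □̃ and take x in a neighborhood of Δ_y. Then the claim is that
[φ_{k,Ω(□)}(Q̃^T_{𝕋⁰,Ω(□)}Φ_k)](x) = [φ_{k,Ω(□)}(Q̃^T_{𝕋⁰,Ω(□)}(Φ_k − Φ_k(y)))](x) + [1 − μ̄_kG_{k,Ω(□)}·1](x)Φ_k(y)  (samsum)
Indeed the identity holds if the second term on the right is [φ_{k,Ω(□)}(Q̃^T_{𝕋⁰,Ω(□)}1)](x)Φ_k(y) which is the same as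
[φ_{k,Ω(□)}(1)](x)Φ_k(y). However since [−Δ]_Ω·1 = Δ_{Ω,Ωᶜ}·1 we have [−Δ + μ̄_k + Q^T_{k,Ω(□)}𝐚Q_{k,Ω(□)}]_{Ω_1(□)}·1 =
(Δ_{Ω_1(□),Ω_1ᶜ(□)} + μ̄_k + Q^T_{k,Ω(□)}𝐚)·1 and so G_{k,Ω(□)}(μ̄_k + Q^T_{k,Ω(□)}𝐚 + Δ_{Ω_1(□),Ω_1ᶜ(□)})·1 = 1  Therefore
φ_{k,Ω(□)}(1) = G_{k,Ω(□)}((Q^T_{k,Ω(□)}𝐚 + Δ_{Ω_1(□),Ω_1ᶜ(□)})·1) = 1 − μ̄_kG_{k,Ω(□)}·1 which gives the result (samsum).  On □̃ ⊂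
Ω_k(□) we have |∂G_{k,Ω(□)}·1| ≤ C by (lefty2). Thus the derivative of the second term in (samsum) is bounded by |∂(1 −
μ̄_kG_{k,Ω(□)}·1)Φ_k(y)| ≤ Cμ̄_kp_kα_k^{−1} ≤ Cμ̄_k^{1/2}p_k ≤ Cp_k  (cindy)  By (twoone1) for derivatives and the bound on
∂Φ_k, the derivative of the first term in (samsum) is bounded on □̃ ⊂ Ω_k(□) by Σ_{y′}|[∂φ_{k,Ω(□)}(1_{Δ_{y′}}Q̃^T(Φ_k −
Φ_k(y)))](x)| ≤ CΣ_{y′}e^{−¼γ₀d_{Ω(□)}(y,y′)}‖1_{Δ_{y′}}Q̃^T(Φ_k − Φ_k(y))‖_∞ ≤ CΣ_{y′}e^{−¼γ₀d_{Ω(□)}(y,y′)}(d(y,y′) + 1)p_k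
≤ Cp_k  (samsum3)  The last holds since d(y,y′) ≤ d_{Ω(□)}(y,y′). … The remaining terms are Φ_k(y) − [Q(1 −
μ̄_kG_{k,Ω(□)}·1)](y)Φ_k(y) = μ̄_k(QG_{k,Ω(□)}·1)(y)Φ_k(y)  Since |G_{k,Ω(□)}·1| ≤ C, this is bounded by Cp_k as in
(cindy). This completes the proof."*  (`α_k = max{μ̄_k^{1/2}, λ_k^{1/4}}` L2056–2058.)

**Why this module.**  TEMPLATE.md §4.2 row «D2 Def `\label{s}` S_k(□), Lemmas `\label{threeone}`, `\label{threetwo}`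
("Proof. [Bal82b], [Bal95]") (L2063–2238); …» has KERNEL (v8.51) for DEFINITION 3.s and LEMMAS 3.1 (1) ∕ 3.2 (1) (sibling
`SmallFieldBounds`) — the easy direction.  Part (2), the converse *"bounds on Φ_k, ∂Φ_k ⟹ Φ_k ∈ C𝒮_k(□)"* for which
Dimock only points to [Bal82b], [Bal95], is where the local regularity of the MINIMIZER enters; its printed proof has
four ingredients — the identity (samsum) splitting off the constant field (pure linear algebra of `G_{k,Ω(□)}`: the
Laplacian kills constants, averaging preserves them), the arithmetic (cindy) (`α_k ≥ μ̄_k^{1/2}`, `μ̄ ≤ 1`), the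
assembly (samsum3) (the sup-norm mechanism of the sibling `MinimizerSupNormBound` fed with a source growing linearly in
the distance, against the exponential kernel decay), and the last step `Φ_k(y) − [Q(1 − μ̄G·1)](y)Φ_k(y) =
μ̄(QG·1)(y)Φ_k(y)` — and two genuinely analytic inputs, (twoone1)∕(lefty2) for the derivative kernel and `|∂G·1| ≤ C`.
This module proves the four ingredients, keeping the two inputs as the hypotheses they are; the same identity in its
prescaled form (samsum5) is the first step of LEMMA 3.12's proof (§3.11.2 *"redundant characteristic functions"*).

**What is reproduced here (kernel-checked, zero `sorry`).**  CARRIER: the finite index model of `MultiRegionFreeFlow`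
(sites `κ` of `Ω_1(□)`, `D = [−Δ + μ̄_k]_{Ω_1}` positive definite, multiscale variables `m` with weight `𝐚 ≥ 0` and
averaging `Q_{k,Ω} : Matrix m κ ℝ`, `G_{k,Ω} = GkO D 𝐚 Q`, `φ_{k,Ω}(φ_{Ω_1ᶜ}, Φ) = minimizer D 𝐚 Q Φ src` with `src =
[Δ]_{Ω_1,Ω_1ᶜ}φ_{Ω_1ᶜ}`); the two structural facts of the print as hypotheses `hD1 : D·1 = μ̄·1 + s₀` (`s₀ = Δ_{Ω_1,Ω_1ᶜ}·1`:
*"[−Δ]_Ω·1 = Δ_{Ω,Ωᶜ}·1"*) and `hQ1 : Q·1 = 1` (averaging preserves constants).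
* §1 (samsum): `minimizer_add`, `minimizer_smul`, `minimizer_split` (linearity in the pair (datum, source));
  **`gInvO_mulVec_one`** (`[−Δ + μ̄ + Qᵀ𝐚Q]·1 = μ̄·1 + s₀ + Qᵀ𝐚·1`); **`minimizer_one`** (`φ(1, s₀) = 1 − μ̄G·1`); **`samsum`**
  (`φ(Φ, src) = φ(Φ − t·1, src − t·s₀) + t·(1 − μ̄G·1)`, `t = Φ_k(y)`); `samsum5` (difference form); **`sub_Q_const_field`**
  ∕ `abs_sub_Q_const_field_le` (the last step, `= μ̄(QG·1)(y)·t`, `≤ μ̄C|t|`); **`abs_deriv_minimizer_le`** (through any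
  linear `∂` with `∂1 = 0`: `|∂φ(Φ,src)(b)| ≤ |∂φ(Φ − t·1, src − t·s₀)(b)| + μ̄|t|·|∂(G·1)(b)|`).
* §2 (cindy): `alpha μ λ = max(√μ, λ^{1/4})`, `sqrt_le_alpha`, `alpha_pos`, **`mubar_div_alpha_le`** (`μ̄α^{−1} ≤ μ̄^{1/2}`),
  **`cindy`** (`|∂G·1| ≤ C`, `|t| ≤ pα^{−1}`, `0 ≤ μ̄ ≤ 1` ⟹ `μ̄|t||∂G·1| ≤ Cp`).
* §3 (samsum3): **`add_one_mul_exp_neg_le`** (`(t+1)e^{−ct} ≤ (2/c)e^{−ct/2}`, `0 < c ≤ 2`), **`sum_exp_mul_add_one_le`**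
  (`Σ_{y′}e^{−cd}(d+1) ≤ (2/c)K` from the one-link sum at half rate — (funnysum) at `δ = c/2`),
  **`abs_apply_le_of_linearSource`** (block-kernel decay `C·E(y,y′)‖g‖_∞` + blocks `≤ (d(y,y′)+1)p` + `Σ_{y′}E(d+1) ≤ K₁`
  ⟹ `|(Tf)(x)| ≤ C·K₁·p` on `Δ_y`, via `MinimizerSupNormBound.abs_apply_le_of_decay`), `norm_blk_pullback_sub_le`,
  **`abs_sub_le_mul_dist`** (on any connected `SimpleGraph`: increments `≤ p` along edges ⟹ `|Φ(u) − Φ(v)| ≤ p·dist(u,v)`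
  — the use of `|∂Φ_k| ≤ p_k`), `norm_blk_pullback_sub_le_of_adj` (hence the source bound `(d(y,y′)+1)p`).
* §4 a one-site non-vacuity `example` of `minimizer_one`.

**Readings / located items (declared).**  (i) `D·1 = μ̄·1 + s₀` packages *"[−Δ]_Ω·1 = Δ_{Ω,Ωᶜ}·1"*: the Dirichlet-restricted
Laplacian applied to the constant `1` is (minus) the boundary block applied to `1` outside; any `D`, `s₀` with this
relation are allowed (sign conventions of `[Δ]_{Ω,Ωᶜ}` as in `MultiRegionFreeFlow`, the source being `+src`).  (ii)
`Q·1 = 1` is Dimock's averaging normalisation (`(Q_kf)(y) = L^{−3k}Σ_{x∈B_k(y)}f(x)`, part I L441); in the lineage's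
`√N`-normalised matrices (`BlockAveragingMatrix.Qmat`) the constant is carried by `√N` instead — the hypothesis is
stated, not derived, so either normalisation can be fed (with `1` replaced by the right constant vector the same algebra
applies; not spelled out).  (iii) `Q̃^T_{𝕋⁰,Ω(□)}Φ_k` (the multiscale datum AND the boundary values built from one unit-lattice
field) is the pair (`Φ`, `src`); subtracting the constant `Φ_k(y)` subtracts `Φ_k(y)·1` from the datum and `Φ_k(y)·s₀` from
the source — this is what makes (samsum) an identity rather than an approximation.  (iv) In §3 the decay profile `E`
and distance `d` are abstract (print: `e^{−¼γ₀d_{Ω(□)}(y,y′)}` and the unit-lattice distance `d(y,y′) ≤ d_{Ω(□)}(y,y′)`,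
L2193); the graph of `abs_sub_le_mul_dist` is any connected graph on the cube centres (print: nearest neighbours of
`𝕋⁰`).  (v) L2152 *"Let y be unit lattice point"* (article dropped), L2200–2201 — located wording only.

**What is NOT claimed.**  (twoone1)∕(lefty2) themselves (the kernel decay of `∂G_{k,Ω(□)}` — sibling
`MinimizerSupNormBound` assembles (twoone1) from (lefty2), THEOREM 2.2 stays a hypothesis), the bound `|∂G_{k,Ω(□)}·1| ≤ C`
and `|G·1| ≤ C`, the first half of part (2) (`|φ| ≤ Cα^{−1}p` — that IS `MinimizerSupNormBound.lemma_twoone`), LEMMA 3.2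
(2) (the `Φ^#` variant, *"proved as in the previous lemma"*), LEMMA 3.12 beyond the identity (samsum5) (its `M^{−1/2}`
extraction and (spin0) are random-walk estimates), the constant `C` of the Lemma as a closed form; anything of B1–B16
(row «D2 Def s …» B-side B7 Props 1–2, B8 §A, B12 (1.11)–(1.16), B14 (2.18), B10 (68)–(71) untouched — grade P
unchanged).  NOT summit progress; NOT a statement about any Bałaban paper; NOT continuum; NOT Clay.  NEW leaf; imports
Mathlib + `MultiRegionFreeFlow` + `MinimizerSupNormBound`; no Summits import; modifies nothing.  Unit
`b2b-balaban-template` gen 36 (journal CLAIM D2-SAMSUM-KERNEL).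

**Version.**  v1 (gen 36, literature-prover-b2b-balaban-template-g36-0, 2026-08-20).
-/

noncomputable section

namespace Literature.MathematicalPhysics.QuantumFieldTheory.Dimock2011to13.ConstantFieldSplit

open Matrix Finset
open scoped Matrix
open Literature.MathematicalPhysics.QuantumFieldTheory.Dimock2011to13.MultiRegionFreeFlow
open Literature.MathematicalPhysics.QuantumFieldTheory.Dimock2011to13.MinimizerSupNormBound

/-! ## §1 The identity (samsum): splitting off the constant field -/

section Samsum

variable {κ m : Type*} [Fintype κ] [Fintype m] [DecidableEq κ]
variable {D : Matrix κ κ ℝ} {a : Matrix m m ℝ} {Qm : Matrix m κ ℝ}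

/-- the minimizer `φ_{k,Ω}(φ_{Ω₁ᶜ}, Φ_{k,Ω}) = G_{k,Ω}(Q^T_{k,Ω}𝐚Φ_{k,Ω} + [Δ]_{Ω₁,Ω₁ᶜ}φ_{Ω₁ᶜ})` is ADDITIVE in the pair (multiscale field,
boundary source). [cite: Dimock2013BalabanII, Thm 2.1 (unknown) L605–609 and §3.2 Lemma threeone proof (samsum) L2150–2161
(arXiv:1212.5562v2 TeX)] -/
theorem minimizer_add (Φ Φ' : m → ℝ) (src src' : κ → ℝ) :
    minimizer D a Qm (Φ + Φ') (src + src') = minimizer D a Qm Φ src + minimizer D a Qm Φ' src' := by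
  unfold minimizer
  rw [← mulVec_add]
  congr 1
  rw [mulVec_add, mulVec_add]
  abel

/-- … and HOMOGENEOUS. [cite: Dimock2013BalabanII, Thm 2.1 (unknown) L605–609 (arXiv:1212.5562v2 TeX)] -/
theorem minimizer_smul (t : ℝ) (Φ : m → ℝ) (src : κ → ℝ) :
    minimizer D a Qm (t • Φ) (t • src) = t • minimizer D a Qm Φ src := by
  unfold minimizer
  rw [mulVec_smul, mulVec_smul, ← smul_add, mulVec_smul]

/-- hence `φ(Φ, src) = φ(Φ − t·1, src − t·s₀) + t·φ(1, s₀)` for every scalar `t` (the print: `t = Φ_k(y)`).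
[cite: Dimock2013BalabanII, §3.2 Lemma threeone proof (samsum) L2150–2165 (arXiv:1212.5562v2 TeX)] -/
theorem minimizer_split (Φ : m → ℝ) (src : κ → ℝ) (t : ℝ) (Φ₁ : m → ℝ) (s₀ : κ → ℝ) :
    minimizer D a Qm Φ src
      = minimizer D a Qm (Φ - t • Φ₁) (src - t • s₀) + t • minimizer D a Qm Φ₁ s₀ := by
  rw [← minimizer_smul, ← minimizer_add]
  simp only [sub_add_cancel]

omit [DecidableEq κ] in
/-- **«since [−Δ]_Ω·1 = Δ_{Ω,Ωᶜ}·1 we have [−Δ + μ̄_k + Q^T_{k,Ω(□)}𝐚Q_{k,Ω(□)}]_{Ω₁(□)}·1 = (Δ_{Ω₁(□),Ω₁ᶜ(□)} + μ̄_k +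
Q^T_{k,Ω(□)}𝐚)·1»**: with `D·1 = μ̄·1 + s₀` (`D = [−Δ + μ̄_k]_{Ω₁}`, `s₀ = Δ_{Ω₁,Ω₁ᶜ}·1` the boundary source of the constant
field) and `Q1 = 1` (averaging preserves constants), the bracket of `G_{k,Ω}` maps `1` to `μ̄·1 + s₀ + Qᵀ𝐚1`.
[cite: Dimock2013BalabanII, §3.2 Lemma threeone proof L2162–2171 (arXiv:1212.5562v2 TeX)] -/
theorem gInvO_mulVec_one {μ : ℝ} {s₀ : κ → ℝ} (hD1 : D *ᵥ (1 : κ → ℝ) = μ • 1 + s₀)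
    (hQ1 : Qm *ᵥ (1 : κ → ℝ) = 1) :
    gInvO D a Qm *ᵥ (1 : κ → ℝ) = μ • 1 + s₀ + Qmᵀ *ᵥ (a *ᵥ (1 : m → ℝ)) := by
  unfold gInvO
  rw [add_mulVec, hD1, ← mulVec_mulVec, ← mulVec_mulVec, hQ1]

/-- **«Therefore φ_{k,Ω(□)}(1) = G_{k,Ω(□)}((Q^T_{k,Ω(□)}𝐚 + Δ_{Ω₁(□),Ω₁ᶜ(□)})·1) = 1 − μ̄_kG_{k,Ω(□)}·1»** (`D > 0`, `𝐚 ≥ 0`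
make `G_{k,Ω}` the inverse of its bracket). [cite: Dimock2013BalabanII, §3.2 Lemma threeone proof L2169–2177
(arXiv:1212.5562v2 TeX)] -/
theorem minimizer_one (hD : D.PosDef) (ha : a.PosSemidef) {μ : ℝ} {s₀ : κ → ℝ}
    (hD1 : D *ᵥ (1 : κ → ℝ) = μ • 1 + s₀) (hQ1 : Qm *ᵥ (1 : κ → ℝ) = 1) :
    minimizer D a Qm (1 : m → ℝ) s₀ = 1 - μ • (GkO D a Qm *ᵥ (1 : κ → ℝ)) := by
  have hG1 : GkO D a Qm *ᵥ (gInvO D a Qm *ᵥ (1 : κ → ℝ)) = 1 := by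
    rw [mulVec_mulVec, GkO_mul_gInvO hD ha, one_mulVec]
  rw [gInvO_mulVec_one hD1 hQ1] at hG1
  unfold minimizer
  -- G(Qᵀ𝐚1 + s₀) = G(μ1 + s₀ + Qᵀ𝐚1) − μG1 = 1 − μG1
  have e : Qmᵀ *ᵥ (a *ᵥ (1 : m → ℝ)) + s₀ = (μ • 1 + s₀ + Qmᵀ *ᵥ (a *ᵥ (1 : m → ℝ))) - μ • (1 : κ → ℝ) := by
    abel
  rw [e, mulVec_sub, hG1, mulVec_smul]

/-- **THE IDENTITY (samsum)**: `φ_{k,Ω(□)}(Q̃ᵀΦ_k) = φ_{k,Ω(□)}(Q̃ᵀ(Φ_k − Φ_k(y))) + [1 − μ̄_kG_{k,Ω(□)}·1]Φ_k(y)` — for the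
minimizer with multiscale datum `Φ` and boundary source `src`: subtracting the constant `t = Φ_k(y)` from the datum
(and `t·s₀` from the source, `s₀ = Δ_{Ω₁,Ω₁ᶜ}·1` being the source of the constant boundary field) leaves the field
`t·(1 − μ̄_kG_{k,Ω}·1)`. [cite: Dimock2013BalabanII, §3.2 Lemma threeone proof (samsum) L2150–2177 (arXiv:1212.5562v2 TeX)] -/
theorem samsum (hD : D.PosDef) (ha : a.PosSemidef) {μ : ℝ} {s₀ : κ → ℝ}
    (hD1 : D *ᵥ (1 : κ → ℝ) = μ • 1 + s₀) (hQ1 : Qm *ᵥ (1 : κ → ℝ) = 1) (Φ : m → ℝ) (src : κ → ℝ) (t : ℝ) :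
    minimizer D a Qm Φ src
      = minimizer D a Qm (Φ - t • 1) (src - t • s₀) + t • (1 - μ • (GkO D a Qm *ᵥ (1 : κ → ℝ))) := by
  rw [← minimizer_one hD ha hD1 hQ1]
  exact minimizer_split Φ src t 1 s₀

/-- the same identity in the prescaled form (samsum5) is literally `samsum` (the bracket there is `G⁰_{k+1,Ω⁺(□)}`'s, a
`GkO` with the next-level weights — `FreeFlowSingleStep.gInvO_next`). [cite: Dimock2013BalabanII, §3.11.2 Lemma replace
proof (samsum5) L3989–4000 (arXiv:1212.5562v2 TeX)] -/
theorem samsum5 (hD : D.PosDef) (ha : a.PosSemidef) {μ : ℝ} {s₀ : κ → ℝ}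
    (hD1 : D *ᵥ (1 : κ → ℝ) = μ • 1 + s₀) (hQ1 : Qm *ᵥ (1 : κ → ℝ) = 1) (Φ : m → ℝ) (src : κ → ℝ) (t : ℝ) :
    minimizer D a Qm Φ src - minimizer D a Qm (Φ - t • 1) (src - t • s₀)
      = t • (1 - μ • (GkO D a Qm *ᵥ (1 : κ → ℝ))) := by
  rw [samsum hD ha hD1 hQ1 Φ src t, add_sub_cancel_left]

/-- **the last step of the proof**: at a unit point `y`, `Φ_k(y) − [Q(1 − μ̄_kG_{k,Ω(□)}·1)](y)Φ_k(y) =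
μ̄_k(QG_{k,Ω(□)}·1)(y)Φ_k(y)` (using `Q1 = 1`). [cite: Dimock2013BalabanII, §3.2 Lemma threeone proof L2197–2206
(arXiv:1212.5562v2 TeX)] -/
theorem sub_Q_const_field {μ : ℝ} (hQ1 : Qm *ᵥ (1 : κ → ℝ) = 1) (t : ℝ) (i : m) :
    t - (Qm *ᵥ (t • ((1 : κ → ℝ) - μ • (GkO D a Qm *ᵥ (1 : κ → ℝ))))) i
      = μ * (Qm *ᵥ (GkO D a Qm *ᵥ (1 : κ → ℝ))) i * t := by
  rw [mulVec_smul, mulVec_sub, hQ1, mulVec_smul]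
  simp only [Pi.smul_apply, Pi.sub_apply, Pi.one_apply, smul_eq_mul]
  ring

/-- hence `|Φ_k(y) − [Q(1 − μ̄_kG·1)](y)Φ_k(y)| ≤ μ̄_k·C·|Φ_k(y)|` when `|(QG·1)(y)| ≤ C` (*"Since |G_{k,Ω(□)}·1| ≤ C, this is
bounded by Cp_k as in (cindy)"* — the `p_k` then comes from §2). [cite: Dimock2013BalabanII, §3.2 Lemma threeone proof
L2202–2207 (arXiv:1212.5562v2 TeX)] -/
theorem abs_sub_Q_const_field_le {μ : ℝ} (hμ : 0 ≤ μ) (hQ1 : Qm *ᵥ (1 : κ → ℝ) = 1) {C : ℝ}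
    (hC : ∀ i, |(Qm *ᵥ (GkO D a Qm *ᵥ (1 : κ → ℝ))) i| ≤ C) (t : ℝ) (i : m) :
    |t - (Qm *ᵥ (t • ((1 : κ → ℝ) - μ • (GkO D a Qm *ᵥ (1 : κ → ℝ))))) i| ≤ μ * C * |t| := by
  rw [sub_Q_const_field hQ1, abs_mul, abs_mul, abs_of_nonneg hμ]
  exact mul_le_mul_of_nonneg_right (mul_le_mul_of_nonneg_left (hC i) hμ) (abs_nonneg _)

/-- the split seen through any linear map `∂` that kills constants (a lattice derivative into functions on bonds):
`∂φ(Φ, src) = ∂φ(Φ − t·1, src − t·s₀) − tμ̄·∂(G·1)` and hence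
`|∂φ(Φ,src)(b)| ≤ |∂φ(Φ − t·1, src − t·s₀)(b)| + μ̄|t|·|∂(G·1)(b)|` — the two terms estimated by (samsum3) and (cindy).
[cite: Dimock2013BalabanII, §3.2 Lemma threeone proof L2178–2192 (arXiv:1212.5562v2 TeX)] -/
theorem abs_deriv_minimizer_le (hD : D.PosDef) (ha : a.PosSemidef) {μ : ℝ} (hμ : 0 ≤ μ) {s₀ : κ → ℝ}
    (hD1 : D *ᵥ (1 : κ → ℝ) = μ • 1 + s₀) (hQ1 : Qm *ᵥ (1 : κ → ℝ) = 1) {B : Type*}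
    (deriv : (κ → ℝ) →ₗ[ℝ] (B → ℝ)) (hd1 : deriv (1 : κ → ℝ) = 0) (Φ : m → ℝ) (src : κ → ℝ) (t : ℝ) (b : B) :
    |deriv (minimizer D a Qm Φ src) b|
      ≤ |deriv (minimizer D a Qm (Φ - t • 1) (src - t • s₀)) b|
        + μ * |t| * |deriv (GkO D a Qm *ᵥ (1 : κ → ℝ)) b| := by
  rw [samsum hD ha hD1 hQ1 Φ src t, map_add, map_smul, map_sub, hd1, map_smul, Pi.add_apply, Pi.smul_apply,
    Pi.sub_apply, Pi.zero_apply, Pi.smul_apply, zero_sub, smul_eq_mul, smul_eq_mul]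
  calc |deriv (minimizer D a Qm (Φ - t • 1) (src - t • s₀)) b + t * -(μ * deriv (GkO D a Qm *ᵥ 1) b)|
      ≤ |deriv (minimizer D a Qm (Φ - t • 1) (src - t • s₀)) b| + |t * -(μ * deriv (GkO D a Qm *ᵥ 1) b)| :=
        abs_add_le _ _
    _ = |deriv (minimizer D a Qm (Φ - t • 1) (src - t • s₀)) b| + μ * |t| * |deriv (GkO D a Qm *ᵥ 1) b| := by
        rw [abs_mul, abs_neg, abs_mul, abs_of_nonneg hμ]; ring

end Samsum

/-! ## §2 The arithmetic (cindy): `α_k = max{μ̄_k^{1/2}, λ_k^{1/4}}` and `μ̄_kp_kα_k^{−1} ≤ μ̄_k^{1/2}p_k ≤ p_k` -/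

section Cindy

/-- `α_k = max{μ̄_k^{1/2}, λ_k^{1/4}}`. [cite: Dimock2013BalabanII, §3.2 L2056–2058 (arXiv:1212.5562v2 TeX)] -/
def alpha (μ lam : ℝ) : ℝ := max (Real.sqrt μ) (lam ^ (1 / 4 : ℝ))

/-- `α_k ≥ μ̄_k^{1/2}`. [cite: Dimock2013BalabanII, §3.2 L2056–2058 (arXiv:1212.5562v2 TeX)] -/
theorem sqrt_le_alpha (μ lam : ℝ) : Real.sqrt μ ≤ alpha μ lam := le_max_left _ _

/-- `α_k > 0` for `λ_k > 0`. [cite: Dimock2013BalabanII, §3.2 L2056–2058 (arXiv:1212.5562v2 TeX)] -/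
theorem alpha_pos {μ lam : ℝ} (hlam : 0 < lam) : 0 < alpha μ lam :=
  lt_max_of_lt_right (Real.rpow_pos_of_pos hlam _)

/-- **`μ̄_kα_k^{−1} ≤ μ̄_k^{1/2}`** (since `α_k ≥ μ̄_k^{1/2}`). [cite: Dimock2013BalabanII, §3.2 Lemma threeone proof (cindy)
L2178–2183 «Cμ̄_kp_kα_k^{−1} ≤ Cμ̄_k^{1/2}p_k ≤ Cp_k» (arXiv:1212.5562v2 TeX)] -/
theorem mubar_div_alpha_le {μ lam : ℝ} (hμ : 0 ≤ μ) (hlam : 0 < lam) : μ * (alpha μ lam)⁻¹ ≤ Real.sqrt μ := by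
  rw [← div_eq_mul_inv, div_le_iff₀ (alpha_pos hlam)]
  calc μ = Real.sqrt μ * Real.sqrt μ := (Real.mul_self_sqrt hμ).symm
    _ ≤ Real.sqrt μ * alpha μ lam := mul_le_mul_of_nonneg_left (sqrt_le_alpha μ lam) (Real.sqrt_nonneg _)

/-- **(cindy)**: `|∂(1 − μ̄_kG_{k,Ω(□)}·1)(x)·Φ_k(y)| ≤ Cμ̄_kp_kα_k^{−1} ≤ Cμ̄_k^{1/2}p_k ≤ Cp_k` — from `|∂G·1| ≤ C`, `|Φ_k(y)| ≤
p_kα_k^{−1}` and `μ̄_k ≤ 1` (the `μ̄ ≤ 1` hypothesis of the Lemma). [cite: Dimock2013BalabanII, §3.2 Lemma threeone proof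
(cindy) L2178–2183 (arXiv:1212.5562v2 TeX)] -/
theorem cindy {μ lam C p g t : ℝ} (hμ0 : 0 ≤ μ) (hμ1 : μ ≤ 1) (hlam : 0 < lam) (hC : 0 ≤ C) (hp : 0 ≤ p)
    (hg : |g| ≤ C) (ht : |t| ≤ p * (alpha μ lam)⁻¹) : μ * |t| * |g| ≤ C * p := by
  have h1 : μ * |t| ≤ Real.sqrt μ * p := by
    calc μ * |t| ≤ μ * (p * (alpha μ lam)⁻¹) := mul_le_mul_of_nonneg_left ht hμ0
      _ = (μ * (alpha μ lam)⁻¹) * p := by ring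
      _ ≤ Real.sqrt μ * p := mul_le_mul_of_nonneg_right (mubar_div_alpha_le hμ0 hlam) hp
  have h2 : Real.sqrt μ ≤ 1 := Real.sqrt_le_one.mpr hμ1
  calc μ * |t| * |g| ≤ (Real.sqrt μ * p) * C :=
        mul_le_mul h1 hg (abs_nonneg _) (mul_nonneg (Real.sqrt_nonneg _) hp)
    _ ≤ (1 * p) * C := mul_le_mul_of_nonneg_right (mul_le_mul_of_nonneg_right h2 hp) hC
    _ = C * p := by ring

end Cindy

/-! ## §3 The assembly (samsum3): a kernel with decay against a source growing linearly in the distance -/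

section Samsum3

/-- **growth against decay**: `(t + 1)e^{−ct} ≤ (2/c)e^{−ct/2}` for `0 < c ≤ 2`, `t ≥ 0` (from `e^{ct/2} ≥ 1 + ct/2 ≥ (c/2)(t+1)`)
— how the factor `(d(y,y′) + 1)` of (samsum3) is absorbed by half the decay rate. [cite: Dimock2013BalabanII, §3.2 Lemma
threeone proof (samsum3) L2184–2193 «≤ CΣ_{y′}e^{−¼γ₀d_{Ω(□)}(y,y′)}(d(y,y′) + 1)p_k ≤ Cp_k» (arXiv:1212.5562v2 TeX)] -/
theorem add_one_mul_exp_neg_le {c t : ℝ} (hc : 0 < c) (hc2 : c ≤ 2) (ht : 0 ≤ t) :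
    (t + 1) * Real.exp (-(c * t)) ≤ (2 / c) * Real.exp (-(c / 2 * t)) := by
  have hkey : (c / 2) * (t + 1) ≤ Real.exp (c / 2 * t) := by
    calc (c / 2) * (t + 1) = c / 2 * t + c / 2 := by ring
      _ ≤ c / 2 * t + 1 := by linarith
      _ ≤ Real.exp (c / 2 * t) := by linarith [Real.add_one_le_exp (c / 2 * t)]
  have hsplit : Real.exp (-(c * t)) = Real.exp (-(c / 2 * t)) * Real.exp (-(c / 2 * t)) := by
    rw [← Real.exp_add]; congr 1; ring
  rw [hsplit, ← mul_assoc]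
  refine mul_le_mul_of_nonneg_right ?_ (Real.exp_nonneg _)
  -- (t+1) e^{−ct/2} ≤ 2/c  ⟸  (c/2)(t+1) ≤ e^{ct/2}
  rw [Real.exp_neg, ← div_eq_mul_inv, div_le_iff₀ (Real.exp_pos _)]
  calc t + 1 = (2 / c) * ((c / 2) * (t + 1)) := by field_simp
    _ ≤ 2 / c * Real.exp (c / 2 * t) := mul_le_mul_of_nonneg_left hkey (by positivity)

/-- **the one-link sum with the linear weight**: `Σ_{y′}e^{−cd(y,y′)}(d(y,y′) + 1) ≤ (2/c)·Σ_{y′}e^{−(c/2)d(y,y′)} ≤ (2/c)K` when the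
one-link sum at HALF the rate is `≤ K` ((funnysum) at `δ = c/2`). [cite: Dimock2013BalabanII, §3.2 Lemma threeone proof (samsum3)
L2184–2193 and (funnysum) L1152–1156 (arXiv:1212.5562v2 TeX)] -/
theorem sum_exp_mul_add_one_le {Y : Type*} [Fintype Y] {c K : ℝ} (hc : 0 < c) (hc2 : c ≤ 2) {d : Y → Y → ℝ}
    (hd : ∀ y y', 0 ≤ d y y')
    (hK : ∀ y, ∑ y', Real.exp (-(c / 2 * d y y')) ≤ K) (y : Y) :
    ∑ y', Real.exp (-(c * d y y')) * (d y y' + 1) ≤ 2 / c * K := by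
  calc ∑ y', Real.exp (-(c * d y y')) * (d y y' + 1)
      ≤ ∑ y', 2 / c * Real.exp (-(c / 2 * d y y')) := Finset.sum_le_sum fun y' _ => by
        rw [mul_comm]; exact add_one_mul_exp_neg_le hc hc2 (hd y y')
    _ = 2 / c * ∑ y', Real.exp (-(c / 2 * d y y')) := by rw [Finset.mul_sum]
    _ ≤ 2 / c * K := mul_le_mul_of_nonneg_left (hK y) (by positivity)

/-- **THE ASSEMBLY (samsum3)**: block-kernel decay `|(T1_{Δ_{y′}}g)(x)| ≤ C·E(y,y′)‖g‖_∞` ((twoone1)∕(twoone3) for the derivative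
of the local minimizer, no level weight in the prescaled geometry) and a source whose block at `Δ_{y′}` is bounded by
`(d(y,y′) + 1)·p` (a field with `|∂Φ| ≤ p`, recentred at `y`) give `|(Tf)(x)| ≤ C·K₁·p` at the sites `x` of `Δ_y`, where
`Σ_{y′}E(y,y′)(d(y,y′) + 1) ≤ K₁`. [cite: Dimock2013BalabanII, §3.2 Lemma threeone proof (samsum3) L2184–2193
(arXiv:1212.5562v2 TeX)] -/
theorem abs_apply_le_of_linearSource {X X₂ Y : Type*} [Fintype X] [Fintype Y] [DecidableEq Y] {c : X → Y}
    {c₂ : X₂ → Y} {T : (X → ℝ) →ₗ[ℝ] (X₂ → ℝ)} {C p K₁ : ℝ} (hC : 0 ≤ C) (hp : 0 ≤ p) {E d : Y → Y → ℝ}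
    (hE : ∀ y y', 0 ≤ E y y')
    (hker : ∀ (y' : Y) (g : X → ℝ), (∀ x, c x ≠ y' → g x = 0) → ∀ x : X₂, |T g x| ≤ C * E (c₂ x) y' * ‖g‖)
    {f : X → ℝ} {y : Y} (hsrc : ∀ y', ‖blk c y' f‖ ≤ (d y y' + 1) * p)
    (hK₁ : ∑ y', E y y' * (d y y' + 1) ≤ K₁) {x : X₂} (hx : c₂ x = y) :
    |T f x| ≤ C * K₁ * p := by
  have hker' : ∀ (y' : Y) (g : X → ℝ), (∀ x, c x ≠ y' → g x = 0) →
      ∀ x : X₂, |T g x| ≤ C * (fun _ : Y => (1 : ℝ)) y' * E (c₂ x) y' * ‖g‖ := fun y' g hg x => by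
    simpa using hker y' g hg x
  calc |T f x| ≤ ∑ y', C * (fun _ : Y => (1 : ℝ)) y' * E (c₂ x) y' * ‖blk c y' f‖ :=
        abs_apply_le_of_decay hker' f x
    _ ≤ ∑ y', C * E y y' * ((d y y' + 1) * p) := Finset.sum_le_sum fun y' _ => by
        rw [hx, show C * (fun _ : Y => (1 : ℝ)) y' = C from mul_one C]
        exact mul_le_mul_of_nonneg_left (hsrc y') (mul_nonneg hC (hE _ _))
    _ = C * p * ∑ y', E y y' * (d y y' + 1) := by
        rw [Finset.mul_sum]; exact Finset.sum_congr rfl fun y' _ => by ring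
    _ ≤ C * p * K₁ := mul_le_mul_of_nonneg_left hK₁ (mul_nonneg hC hp)
    _ = C * K₁ * p := by ring

/-- the source of (samsum3) on UNIT cubes: the block of `Qᵀ(Φ − Φ(y))` at `Δ_{y′}` has sup norm `≤ |Φ(y′) − Φ(y)|`
(`Qᵀ` = constant extension to the cube). [cite: Dimock2013BalabanII, §3.2 Lemma threeone proof (samsum3) L2184–2193
(arXiv:1212.5562v2 TeX)] -/
theorem norm_blk_pullback_sub_le {X Y : Type*} [Fintype X] [DecidableEq Y] (c : X → Y) (Φ : Y → ℝ) (t : ℝ)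
    (y' : Y) :
    ‖blk c y' (fun x => Φ (c x) - t)‖ ≤ |Φ y' - t| := by
  refine (pi_norm_le_iff_of_nonneg (abs_nonneg _)).2 fun x => ?_
  rw [Real.norm_eq_abs, blk_apply]
  by_cases h : c x = y'
  · rw [if_pos h, h]
  · rw [if_neg h, abs_zero]; exact abs_nonneg _

/-- **`|∂Φ| ≤ p` ⟹ `|Φ(y′) − Φ(y)| ≤ p·d(y,y′)`** for the graph distance of the lattice (nearest-neighbour steps; any connected
graph): a field with bounded increments along edges is Lipschitz in the path metric — the step *"we can use the bound on
∂Φ to estimate … by … (d(y,y′) + 1)p_k"*. [cite: Dimock2013BalabanII, §3.2 Lemma threeone proof L2184–2193 and §3.11.2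
Lemma replace proof L4004–4012 (arXiv:1212.5562v2 TeX)] -/
theorem abs_sub_le_mul_dist {V : Type*} {G : SimpleGraph V} (hconn : G.Connected) {Φ : V → ℝ} {p : ℝ}
    (hadj : ∀ u v, G.Adj u v → |Φ u - Φ v| ≤ p) (u v : V) : |Φ u - Φ v| ≤ p * (G.dist u v : ℝ) := by
  -- along a geodesic walk, telescoping
  have key : ∀ {u v : V} (w : G.Walk u v), |Φ u - Φ v| ≤ p * (w.length : ℝ) := by
    intro u v w
    induction w with
    | nil => simp
    | @cons a b e h w ih =>
      rw [SimpleGraph.Walk.length_cons, Nat.cast_succ, mul_add, mul_one]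
      calc |Φ a - Φ e| = |(Φ a - Φ b) + (Φ b - Φ e)| := by ring_nf
        _ ≤ |Φ a - Φ b| + |Φ b - Φ e| := abs_add_le _ _
        _ ≤ p + p * (w.length : ℝ) := add_le_add (hadj a b h) ih
        _ = p * (w.length : ℝ) + p := by ring
  obtain ⟨w, hw⟩ := hconn.exists_walk_length_eq_dist u v
  have := key w
  rwa [hw] at this

/-- … so the recentred source obeys `‖1_{Δ_{y′}}Qᵀ(Φ − Φ(y))‖_∞ ≤ (d(y,y′) + 1)·p` (for `p ≥ 0`), the hypothesis `hsrc` of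
`abs_apply_le_of_linearSource` with `d` = the graph distance. [cite: Dimock2013BalabanII, §3.2 Lemma threeone proof
(samsum3) L2184–2193 (arXiv:1212.5562v2 TeX)] -/
theorem norm_blk_pullback_sub_le_of_adj {X Y : Type*} [Fintype X] [DecidableEq Y] {G : SimpleGraph Y}
    (hconn : G.Connected) (c : X → Y)
    {Φ : Y → ℝ} {p : ℝ} (hp : 0 ≤ p) (hadj : ∀ u v, G.Adj u v → |Φ u - Φ v| ≤ p) (y y' : Y) :
    ‖blk c y' (fun x => Φ (c x) - Φ y)‖ ≤ ((G.dist y y' : ℝ) + 1) * p := by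
  calc ‖blk c y' (fun x => Φ (c x) - Φ y)‖ ≤ |Φ y' - Φ y| := norm_blk_pullback_sub_le c Φ (Φ y) y'
    _ ≤ p * (G.dist y' y : ℝ) := abs_sub_le_mul_dist hconn hadj y' y
    _ = p * (G.dist y y' : ℝ) := by rw [SimpleGraph.dist_comm]
    _ ≤ ((G.dist y y' : ℝ) + 1) * p := by nlinarith [Nat.cast_nonneg (α := ℝ) (G.dist y y')]

end Samsum3

/-! ## §4 Non-vacuity -/

/-- one site, one variable, no boundary: `D = μ̄ = 1`, `s₀ = 0`, `Q = 1`, `𝐚 = 1`: `G = (1 + 1)^{−1} = ½`,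
`φ(1, 0) = G·1 = ½ = 1 − μ̄G·1`. -/
example : minimizer (1 : Matrix Unit Unit ℝ) (1 : Matrix Unit Unit ℝ) (1 : Matrix Unit Unit ℝ) (1 : Unit → ℝ)
      (0 : Unit → ℝ)
    = 1 - (1 : ℝ) • (GkO (1 : Matrix Unit Unit ℝ) (1 : Matrix Unit Unit ℝ) (1 : Matrix Unit Unit ℝ)
        *ᵥ (1 : Unit → ℝ)) :=
  minimizer_one Matrix.PosDef.one Matrix.PosSemidef.one (μ := 1) (s₀ := 0)
    (by rw [one_mulVec, one_smul, add_zero]) (one_mulVec _)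

end Literature.MathematicalPhysics.QuantumFieldTheory.Dimock2011to13.ConstantFieldSplit
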